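import Literature.NumberTheory.LFunctions.WeilExplicitDirichlet
import Literature.NumberTheory.LFunctions.CharZeroSum
import Literature.NumberTheory.LFunctions.Weil1952CriterionProofs
import HarnessLib

/-!
# Weil's criterion for `L(s, χ)` AS PRINTED: the «il faut» half on Weil's class (A), (B)

Sibling proof file of `Literature/NumberTheory/LFunctions/WeilExplicitDirichlet.lean`, which types
the «lemme» of

> A. Weil, *Sur les «formules explicites» de la théorie des nombres premiers*, Comm. Sém. Math.
> Univ. Lund, Tome suppl. (1952) 252–265 [bib: `Weil1952FormulesExplicites`], p. 262,

for a primitive Dirichlet character `χ` mod `q ≠ 1` as the named fact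
`Literature.NumberTheory.LFunctions.Weil1952_criterion_dirichlet :
GRH(χ) ↔ ∀ F₀, IsWeil1952Test F₀ → ∃ Z, HasWeilZeroSideChar χ (F₀ ⋆ F̃₀) Z ∧ 0 ≤ Z`.

Here the «il faut» half is PROVED, unconditionally and on Weil's FULL test class (A), (B):

* `Weil1952_criterion_dirichlet_mp`: for `χ` primitive mod `q ≠ 1`, if every zero of `L(s, χ)`
  with `0 < Re s < 1` lies on `Re s = ½` (`DirichletCharacter.RiemannHypothesis χ`), then for every
  `F₀` satisfying (A), (B) the symmetric zero sum `Σ_{|Im ρ| ≤ T} m_χ(ρ) Φ(ρ)` of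
  `F = F₀ * \overline{F₀(−x)}` converges as `T → ∞`, to a value `≥ 0`.

This is Weil's own argument (p. 262, the two sentences after the «lemme», uniform in `(k, χ)`):
"si `Φ₀` est la transformée de Mellin de `F₀`, celle de `F` est `Φ(s) = Φ₀(s) \overline{Φ₀(1 − s̄)}`.
Si donc tous les zéros `ω` de `L(s)` dans la bande critique sont sur `σ = ½`, le premier membre de
(11) est `≥ 0`", with the EXISTENCE of the limit obtained — instead of from Weil's general explicit
formula (11), which the tree has for `χ` only on `C_c^∞` and as a named fact
(`explicit_formula_dirichlet`) — from absolute convergence: on the critical line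
`Φ(ρ) = |Φ₀(ρ)|²` (`Weil1952.weilMellin_autocorr_of_integrable`, `F₀ ∈ L¹` by
`IsWeil1952Test.integrable`), `|Φ₀(½ + iγ)|² ≤ C²/(1 + γ²)`
(`IsWeil1952Test.exists_norm_weilMellin_mul_le`, the decay of the transform on Weil's class), and
`Σ_ρ m_χ(ρ)/(1 + γ²) < ∞` over the non-trivial zeros of `L(s, χ)`
(`ExplicitPsiChar.summable_zeroOrder_div_one_add_sq`, `CharZeroSum.lean`; Montgomery–Vaughan
Thm. 10.17), so the truncations `lfunctionZeroBox χ T` — cofinal in the finite subsets of the zero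
set (`ExplicitPsiChar.tendsto_charZeroFinset`) — converge to the `tsum`
(`hasWeilZeroSideChar_tsum`), a sum of non-negative reals.

The `ζ`-case is `Weil1952_criterion_zeta_holds` (`Weil1952CriterionProofs.lean`).  The «il suffit»
half for `χ` (positivity on Weil's class ⇒ `GRH(χ)`, via `C_c^∞ ⊂` (A), (B) and a character
analogue of Bombieri 2000 Thm. 1's converse) is NOT proved here; with it,
`Weil1952_criterion_dirichlet` follows from `Weil1952_criterion_dirichlet_mp` by `Iff.intro`.

## References

* A. Weil, Comm. Sém. Math. Univ. Lund, Tome suppl. (1952) 252–265 = Œuvres Sci. II [1952b]: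
  the «lemme» and the two sentences after it, p. 262. [Weil1952FormulesExplicites]
* H. L. Montgomery, R. C. Vaughan, *Multiplicative Number Theory I* (2007), Thm. 10.17 (zero
  density of `L(s, χ)`, behind `summable_zeroOrder_div_one_add_sq`). [MontgomeryVaughan2007]
-/

noncomputable section

open Complex Filter Set MeasureTheory
open scoped Real Topology ComplexConjugate ComplexOrder

namespace Literature.NumberTheory.LFunctions

open ExplicitPsiChar

variable {q : ℕ} [NeZero q] {χ : DirichletCharacter ℂ q}

/-- The truncated zero side of `L(s, χ)` is the `Finset` sum over `charZeroFinset hχ T`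
(character analogue of `weilZeroSidePartial_eq_sum`). [folklore] -/
private theorem weilZeroSidePartialChar_eq_sum (hχ : χ ≠ 1) (g : ℝ → ℂ) (T : ℝ) :
    weilZeroSidePartialChar χ g T =
      ∑ ρ ∈ charZeroFinset hχ T, (DirichletDisc.zeroOrder χ (ρ : ℂ) : ℂ) * weilMellin g ρ := by
  rw [sum_charZeroFinset_eq hχ T (fun z ↦ (DirichletDisc.zeroOrder χ z : ℂ) * weilMellin g z),
    weilZeroSidePartialChar, finsum_mem_eq_finite_toFinset_sum _ (lfunctionZeroBox_finite hχ T)]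

/-- **The zero side of `L(s, χ)` converges when it converges absolutely termwise**: if
`Σ_ρ ‖m_χ(ρ) ĝ(ρ)‖ < ∞` over the non-trivial zeros then `HasWeilZeroSideChar χ g (Σ' ρ, m_χ(ρ) ĝ(ρ))`
(the truncations `|Im ρ| ≤ T` are cofinal among the finite subsets of the zero set,
`ExplicitPsiChar.tendsto_charZeroFinset`).  Character analogue of `hasWeilZeroSide_tsum`; private
copy (the GRH arm's `WeilCriterionConverseDirichlet.lean` carries the public version
`WeilConverseChar.hasWeilZeroSideChar_tsum` with the same statement). [folklore] -/
private theorem hasWeilZeroSideChar_tsum (hχ : χ ≠ 1) {g : ℝ → ℂ}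
    (hg : Summable fun ρ : charNontrivialZeros χ ↦
      ‖(DirichletDisc.zeroOrder χ (ρ : ℂ) : ℂ) * weilMellin g ρ‖) :
    HasWeilZeroSideChar χ g
      (∑' ρ : charNontrivialZeros χ, (DirichletDisc.zeroOrder χ (ρ : ℂ) : ℂ) * weilMellin g ρ) := by
  unfold HasWeilZeroSideChar
  have h := hg.of_norm.hasSum.comp (tendsto_charZeroFinset hχ)
  refine h.congr fun T ↦ ?_
  simp only [Function.comp_apply, weilZeroSidePartialChar_eq_sum hχ]

/-- **The «il faut» half of Weil's lemma for `L(s, χ)` on Weil's own class (A), (B)** — for `χ`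
primitive mod `q ≠ 1`: if all zeros of `L(s, χ)` with `0 < Re s < 1` lie on `Re s = ½`, then for
every `F₀` satisfying (A), (B) the symmetric zero sum of `F₀ ⋆ F̃₀` converges, to a value `≥ 0`.
Weil 1952, p. 262: "celle de F est `Φ(s) = Φ₀(s) \overline{Φ₀(1 − s̄)}`. Si donc tous les zéros
`ω` de `L(s)` dans la bande critique sont sur `σ = ½`, le premier membre de (11) est `≥ 0`" — on
the critical line `Φ(ω) = |Φ₀(ω)|²` (`Weil1952.weilMellin_autocorr_of_integrable`); the sum
converges absolutely since `|Φ₀(½ + iγ)|² ≤ C²/(1 + γ²)`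
(`IsWeil1952Test.exists_norm_weilMellin_mul_le`) and `Σ m_χ(ρ)/(1 + γ²) < ∞`
(`ExplicitPsiChar.summable_zeroOrder_div_one_add_sq`, Montgomery–Vaughan Thm. 10.17).  This is the
`→` half of the named fact `Weil1952_criterion_dirichlet`, unconditionally (no explicit formula).
[cite: Weil1952FormulesExplicites, the «lemme» p. 262 («il faut»)] -/
theorem Weil1952_criterion_dirichlet_mp (hq : q ≠ 1) (hχ : χ.IsPrimitive)
    (hGRH : χ.RiemannHypothesis) {F₀ : ℝ → ℂ} (hF₀ : IsWeil1952Test F₀) :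
    ∃ Z : ℂ, HasWeilZeroSideChar χ (weilConv F₀ (weilReflect F₀)) Z ∧ 0 ≤ Z := by
  have hq1 : 1 < q := Nat.one_lt_iff_ne_zero_and_ne_one.2 ⟨NeZero.ne q, hq⟩
  have hχ1 : χ ≠ 1 := ne_one_of_isPrimitive hχ hq1
  obtain ⟨C, hC⟩ := hF₀.exists_norm_weilMellin_mul_le
  have hint : Integrable F₀ := hF₀.integrable
  have hre : ∀ ρ ∈ charNontrivialZeros χ, ρ.re = 1 / 2 := fun ρ hρ ↦ hGRH ρ hρ.1 hρ.2.1 hρ.2.2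
  have hterm : ∀ ρ ∈ charNontrivialZeros χ,
      weilMellin (weilConv F₀ (weilReflect F₀)) ρ = (Complex.normSq (weilMellin F₀ ρ) : ℂ) :=
    fun ρ hρ ↦ Weil1952.weilMellin_autocorr_of_integrable hint (hre ρ hρ)
  -- `|Φ(ρ)| = |Φ₀(ρ)|² ≤ C²/(1 + |γ|)² ≤ C²/(1 + γ²)`
  have hbound : ∀ ρ ∈ charNontrivialZeros χ,
      ‖weilMellin (weilConv F₀ (weilReflect F₀)) ρ‖ ≤ C ^ 2 / (1 + ρ.im ^ 2) := by
    intro ρ hρ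
    have hρeq : (1 / 2 + ρ.im * I : ℂ) = ρ := by
      apply Complex.ext
      · simp [hre ρ hρ]
      · simp
    have h1 := hC ρ.im
    rw [hρeq] at h1
    have hpos : 0 < 1 + |ρ.im| := by positivity
    have h2 : ‖weilMellin F₀ ρ‖ ≤ C / (1 + |ρ.im|) := by
      rw [le_div_iff₀ hpos]
      exact h1
    have h3 : ‖weilMellin F₀ ρ‖ ^ 2 ≤ (C / (1 + |ρ.im|)) ^ 2 :=
      pow_le_pow_left₀ (norm_nonneg _) h2 2
    rw [hterm ρ hρ, Complex.norm_real, Real.norm_eq_abs, abs_of_nonneg (Complex.normSq_nonneg _),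
      Complex.normSq_eq_norm_sq]
    refine h3.trans ?_
    rw [div_pow, div_le_div_iff₀ (by positivity) (by positivity)]
    have h4 : 1 + ρ.im ^ 2 ≤ (1 + |ρ.im|) ^ 2 := by nlinarith [abs_nonneg ρ.im, sq_abs ρ.im]
    exact mul_le_mul_of_nonneg_left h4 (sq_nonneg C)
  -- absolute convergence over the non-trivial zeros of `L(s, χ)` (MV Thm. 10.17)
  have hsum : Summable fun ρ : charNontrivialZeros χ ↦
      ‖(DirichletDisc.zeroOrder χ (ρ : ℂ) : ℂ) * weilMellin (weilConv F₀ (weilReflect F₀)) ρ‖ := by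
    refine summable_of_norm_le_mul_zeroOrder_div hχ hq1 (B := C ^ 2) fun ρ ↦ ?_
    rw [norm_mul, Complex.norm_natCast]
    calc (DirichletDisc.zeroOrder χ (ρ : ℂ) : ℝ) * ‖weilMellin (weilConv F₀ (weilReflect F₀)) ρ‖
        ≤ (DirichletDisc.zeroOrder χ (ρ : ℂ) : ℝ) * (C ^ 2 / (1 + (ρ : ℂ).im ^ 2)) :=
          mul_le_mul_of_nonneg_left (hbound ρ ρ.2) (Nat.cast_nonneg _)
      _ = C ^ 2 * ((DirichletDisc.zeroOrder χ (ρ : ℂ) : ℝ) / (1 + (ρ : ℂ).im ^ 2)) := by ring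
  refine ⟨_, hasWeilZeroSideChar_tsum hχ1 hsum, ?_⟩
  have hfun : (fun ρ : charNontrivialZeros χ ↦
      (DirichletDisc.zeroOrder χ (ρ : ℂ) : ℂ) * weilMellin (weilConv F₀ (weilReflect F₀)) ρ) =
      fun ρ : charNontrivialZeros χ ↦
        (((DirichletDisc.zeroOrder χ (ρ : ℂ) : ℝ) * Complex.normSq (weilMellin F₀ ρ) : ℝ) : ℂ) := by
    funext ρ
    rw [hterm ρ ρ.2]
    push_cast
    ring
  rw [hfun, ← Complex.ofReal_tsum]
  exact Complex.zero_le_real.2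
    (tsum_nonneg fun ρ ↦ mul_nonneg (Nat.cast_nonneg _) (Complex.normSq_nonneg _))

end Literature.NumberTheory.LFunctions

end
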